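import Summits.HubbardSuperconductivity.HubbardSuperconductivity.Theorems.LevyLogBootstrapBlock2InfDivXXZFourZero
import HarnessLib

/-!
# Crux `Block2InfDivXXZ` (stmt-HubbardSuperconductivity-15048, route `LevyLogBootstrap`):
# the `M = 4` slice at any `Δ ∈ [-1, 0]` from ONE corner inequality / from rational enclosures

Sequel of `…Block2InfDivXXZFourZero.lean` (the `M = 4`, `Δ = 0` instance). For the `4 × 4` torus the
crux "every fractional Hadamard power of the 2×2-block transverse kernel `K₂` of a normalised
`S^z_tot = 0` sector ground state `ψ` of `H_4(Δ)` is positive semidefinite" is equivalent to the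
three Lévy sign conditions on the coarse torus `(ℤ/2)²`, and with the block values
`A = k₂(0,0) = 2 + 8u + 2s`, `B = k₂(1,0) = k₂(0,1) = 4u + 2s + 4w + 4x`, `C = k₂(1,1) = 2s + 8x + 4y`
(`u = F(1,0)`, `s = F(1,1) + F(1,3)`, `w = F(2,0)`, `x = F(2,1)`, `y = F(2,2)`,
`F(z) = Re⟨ψ, S⁺_z S⁻_0 ψ⟩`; `Block2Four.blockSum_*`) these read `C ≤ A` — unconditional, Gram
positivity — and the CORNER `B² ≤ A C`. This file isolates that endgame so that any source of the
corner closes the slice: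

* `levyCoeff_four_nonneg_of_corner`, `block2InfDivXXZ_four_of_corner` — for every `Δ ∈ [-1, 0]`
  and every sector ground state: the single inequality `(4u + 2s + 4w + 4x)² ≤ (2 + 8u + 2s)(2s + 8x + 4y)`
  on five real numbers read off the state implies all `ν_q ≥ 0`, hence the `M = 4` slice at `Δ`;
* `levyCoeff_four_nonneg_of_bounds`, `block2InfDivXXZ_four_of_bounds` — the same from two-sided
  ENCLOSURES `u ∈ [u⁻, u⁺]`, `s ∈ [s⁻, s⁺]`, `x ∈ [x⁻, x⁺]`, `w ≤ w⁺`, `y ≥ y⁻` and the single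
  numerical check `(4u⁺ + 2s⁺ + 4w⁺ + 4x⁺)² ≤ (2 + 8u⁻ + 2s⁻)(2s⁻ + 8x⁻ + 4y⁻)` (with
  `0 ≤ 2s⁻ + 8x⁻ + 4y⁻`): the interface for a ground-state enclosure certificate of the `M = 4` slice
  on all of `[-1, 0]` (the item's evidence `EVIDENCE-certm4.md` certifies exactly such enclosures
  numerically; with the hypercube symmetry of the `4 × 4` torus `F(1,1) = F(1,3) = F(2,0)`).

At `Δ = 0` the corner comes from Griffiths–Ginibre triangles (`block2InfDivXXZ_four_zero`); for
`Δ < 0` no analytic source is known. Sources: Schoenberg (1938); Berg–Christensen–Ressel (1984)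
Ch. 3 Thm. 2.2; Tasaki (2020) §2.1, §2.4 (symmetries, Perron–Frobenius). No definition; sorry-free.
-/

noncomputable section

set_option linter.dupNamespace false

namespace Summit.HubbardSuperconductivity.HubbardSuperconductivity.Theorems.LevyLogBootstrap

open scoped BigOperators Matrix ComplexOrder ComplexConjugate
open Matrix Finset Complex
open Literature.MathematicalPhysics.QuantumLattice Literature.Probability.LatticeModels
open Block2Four

section FourTorus

/-- **`M = 4`, any `Δ ∈ [-1, 0]`: the corner inequality alone gives all three Lévy sign
conditions.** For a normalised `S^z_tot = 0` sector ground state `ψ` of `H_4(Δ)` write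
`F(z) = Re⟨ψ, S⁺_z S⁻_0 ψ⟩`, `u = F(1,0)`, `s = F(1,1) + F(1,3)`, `w = F(2,0)`, `x = F(2,1)`,
`y = F(2,2)`. If `(4u + 2s + 4w + 4x)² ≤ (2 + 8u + 2s)(2s + 8x + 4y)` (`B² ≤ AC` for the block
values of `Block2Four.blockSum_*`, `F(0) = ½`), then every Lévy coefficient `ν_q`, `q ≠ 0` in
`(ℤ/2)²`, of the 2×2-block kernel is nonnegative: `C ≤ A` is Gram positivity
(`TorusBlock.blockKernel_le_diag`), `B = k₂(1,0) = k₂(0,1)` is bookkeeping, and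
`levy_nonneg_of_corner` does the rest. [folklore] -/
theorem levyCoeff_four_nonneg_of_corner (Δ : ℝ) (hΔ : Δ ∈ Set.Icc (-1:ℝ) 0)
    (ψ : TensorIndex (TorusSite 2 4) 2 → ℂ)
    (hψ : ψ ∈ @spinZSector (TorusSite 2 4) _ _ 1 0) (hnorm : star ψ ⬝ᵥ ψ = 1)
    (heig : Matrix.mulVec (xxzHamiltonian 1 (torusGraph 2 4) (-1) Δ) ψ =
      ((lowestEnergyInSector 1 (xxzHamiltonian 1 (torusGraph 2 4) (-1) Δ) 0 : ℝ) : ℂ) • ψ)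
    (hcorner :
      (4 * (star ψ ⬝ᵥ (onSite ![1, 0] (spinRaise 1) * onSite 0 (spinLower 1)) *ᵥ ψ).re +
          2 * ((star ψ ⬝ᵥ (onSite ![1, 1] (spinRaise 1) * onSite 0 (spinLower 1)) *ᵥ ψ).re +
            (star ψ ⬝ᵥ (onSite ![1, 3] (spinRaise 1) * onSite 0 (spinLower 1)) *ᵥ ψ).re) +
          4 * (star ψ ⬝ᵥ (onSite ![2, 0] (spinRaise 1) * onSite 0 (spinLower 1)) *ᵥ ψ).re +
          4 * (star ψ ⬝ᵥ (onSite ![2, 1] (spinRaise 1) * onSite 0 (spinLower 1)) *ᵥ ψ).re) ^ 2 ≤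
        (4 * (1 / 2) + 8 * (star ψ ⬝ᵥ (onSite ![1, 0] (spinRaise 1) * onSite 0 (spinLower 1)) *ᵥ ψ).re +
          2 * ((star ψ ⬝ᵥ (onSite ![1, 1] (spinRaise 1) * onSite 0 (spinLower 1)) *ᵥ ψ).re +
            (star ψ ⬝ᵥ (onSite ![1, 3] (spinRaise 1) * onSite 0 (spinLower 1)) *ᵥ ψ).re)) *
        (2 * ((star ψ ⬝ᵥ (onSite ![1, 1] (spinRaise 1) * onSite 0 (spinLower 1)) *ᵥ ψ).re +
            (star ψ ⬝ᵥ (onSite ![1, 3] (spinRaise 1) * onSite 0 (spinLower 1)) *ᵥ ψ).re) +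
          8 * (star ψ ⬝ᵥ (onSite ![2, 1] (spinRaise 1) * onSite 0 (spinLower 1)) *ᵥ ψ).re +
          4 * (star ψ ⬝ᵥ (onSite ![2, 2] (spinRaise 1) * onSite 0 (spinLower 1)) *ᵥ ψ).re)) :
    ∀ q : TorusSite 2 2, q ≠ 0 →
      0 ≤ ∑ X : TorusSite 2 2, Real.log (∑ x' : TorusSite 2 4, ∑ y' : TorusSite 2 4,
            if (∀ i : Fin 2, (x' i).val / 2 = (X i).val) ∧ (∀ i : Fin 2, (y' i).val / 2 = 0) then
              (star ψ ⬝ᵥ Matrix.mulVec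
                (onSite x' (spinRaise 1) * onSite y' (spinLower 1)) ψ).re
            else 0) * (torusChar q X).re := by
  intro q hq
  have hEven : Even 4 := ⟨2, rfl⟩
  -- the site kernel `K` and the difference kernel `F`
  set K : TorusSite 2 4 → TorusSite 2 4 → ℝ := fun a b =>
    (star ψ ⬝ᵥ (onSite a (spinRaise 1) * onSite b (spinLower 1)) *ᵥ ψ).re with hKdef
  set F : TorusSite 2 4 → ℝ := fun z => K z 0 with hFdef
  have hKF : ∀ a b : TorusSite 2 4,
      (star ψ ⬝ᵥ (onSite a (spinRaise 1) * onSite b (spinLower 1)) *ᵥ ψ).re = F (a - b) :=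
    fun a b => gs_transverseKernel_eq_sub 4 hEven Δ ψ hψ hnorm heig a b
  have hneg : ∀ z, F (-z) = F z := fun z => gs_transverseKernel_neg 4 hEven Δ ψ hψ hnorm heig z
  have hswap : ∀ a b : ZMod 4, F ![a, b] = F ![b, a] := by
    intro a b
    have h := sectorGS_transverseCorr_compPerm 4 Δ 0 (Equiv.swap (0 : Fin 2) 1) ψ hψ heig ![b, a] 0
    have e1 : ((![b, a] : TorusSite 2 4) ∘ (Equiv.swap (0 : Fin 2) 1)) = ![a, b] := by
      ext i; fin_cases i <;> rfl
    have e2 : ((0 : TorusSite 2 4) ∘ (Equiv.swap (0 : Fin 2) 1)) = 0 := rfl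
    rw [e1, e2] at h
    show (star ψ ⬝ᵥ (onSite ![a, b] (spinRaise 1) * onSite 0 (spinLower 1)) *ᵥ ψ).re =
      (star ψ ⬝ᵥ (onSite ![b, a] (spinRaise 1) * onSite 0 (spinLower 1)) *ᵥ ψ).re
    rw [h]
  -- positivity and half filling
  have hFpos : ∀ z, 0 < F z := fun z =>
    stub_transverseKernelPos 4 hEven le_rfl Δ hΔ ψ hψ hnorm heig z 0
  have hF00 : F ![0, 0] = 1 / 2 := by
    have e : (![0, 0] : TorusSite 2 4) = 0 := by decide
    show K ![0, 0] 0 = 1 / 2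
    rw [e]
    exact LevyFloor.transverseKernel_diag 4 hEven Δ ψ hψ hnorm heig 0
  -- `C ≤ A`: positivity of the Gram form (flatness of block kernels)
  have hT : ∀ v a b : TorusSite 2 4, K (a + v) (b + v) = K a b := fun v a b =>
    gs_transverseKernel_translate 4 hEven Δ ψ hψ hnorm heig v a b
  have hS : ∀ a b : TorusSite 2 4, K a b = K b a := fun a b => re_expect_raiseLower_symm 1 ψ a b
  have hP : ∀ c : TorusSite 2 4 → ℝ, 0 ≤ ∑ a, ∑ b, c a * c b * K a b := fun c =>
    transverse_quadForm_nonneg 1 ψ c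
  have hCA := TorusBlock.blockKernel_le_diag (d := 2) (b := 2) (m := 2) (M := 4) (by norm_num)
    K hT hS hP ![2, 2] 0
  have e22 : ∀ i : Fin 2,
      ((![2, 2] : TorusSite 2 4) i).val / 2 = ((![1, 1] : TorusSite 2 2) i).val := by decide
  have ez : ∀ i : Fin 2, ((0 : TorusSite 2 4) i).val / 2 = 0 := by decide
  have hKF' : ∀ a b : TorusSite 2 4, K a b = F (a - b) := hKF
  simp only [e22, ez, hKF'] at hCA
  rw [blockSum_one_one F hneg hswap, blockSum_zero_zero F hneg hswap, hF00] at hCA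
  -- positivity of `B` and `C`, then the folklore endgame on `(ℤ/2)²`
  have hB : 0 < 4 * F ![1, 0] + 2 * (F ![1, 1] + F ![1, 3]) + 4 * F ![2, 0] + 4 * F ![2, 1] := by
    linarith [hFpos ![1, 0], hFpos ![1, 1], hFpos ![1, 3], hFpos ![2, 0], hFpos ![2, 1]]
  have hC : 0 < 2 * (F ![1, 1] + F ![1, 3]) + 8 * F ![2, 1] + 4 * F ![2, 2] := by
    linarith [hFpos ![1, 1], hFpos ![1, 3], hFpos ![2, 1], hFpos ![2, 2]]
  have hL := levy_nonneg_of_corner _ _ _ hB hC hCA hcorner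
  -- rewrite the Lévy coefficient through the explicit block values
  simp_rw [hKF]
  rw [sum_torusSite_two (α := ZMod 2)]
  simp only [sum_zmod_two]
  rw [blockSum_zero_zero' F hneg hswap, blockSum_zero_one F hneg hswap,
    blockSum_one_zero F hneg hswap, blockSum_one_one F hneg hswap, hF00]
  -- the three nonzero characters of `(ℤ/2)²`
  obtain ⟨a, b, rfl⟩ : ∃ a b : ZMod 2, q = ![a, b] := ⟨q 0, q 1, by ext i; fin_cases i <;> rfl⟩
  have key : ∀ c : ZMod 2, c = 0 ∨ c = 1 := by decide
  rcases key a with rfl | rfl <;> rcases key b with rfl | rfl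
  · exact (hq (by decide)).elim
  · simp only [torusChar_two_re, Matrix.cons_val_zero, Matrix.cons_val_one, val_zero_two,
      val_one_two]
    norm_num
    linarith [hL.1]
  · simp only [torusChar_two_re, Matrix.cons_val_zero, Matrix.cons_val_one, val_zero_two,
      val_one_two]
    norm_num
    linarith [hL.1]
  · simp only [torusChar_two_re, Matrix.cons_val_zero, Matrix.cons_val_one, val_zero_two,
      val_one_two]
    norm_num
    linarith [hL.2]

/-- **The `M = 4` slice of the crux at any `Δ ∈ [-1, 0]` from the corner inequality**
(`levyCoeff_four_nonneg_of_corner` + `block2_rpow_posSemidef_iff_levyCoeff_nonneg`): for every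
normalised `S^z_tot = 0` sector ground state `ψ` of `H_4(Δ)` whose difference kernel satisfies
`(4u + 2s + 4w + 4x)² ≤ (2 + 8u + 2s)(2s + 8x + 4y)`, every fractional Hadamard power of the
2×2-block kernel (the crux's `16 × 16` matrix, verbatim) is positive semidefinite. [folklore] -/
theorem block2InfDivXXZ_four_of_corner (Δ : ℝ) (hΔ : Δ ∈ Set.Icc (-1:ℝ) 0)
    (ψ : TensorIndex (TorusSite 2 4) 2 → ℂ)
    (hψ : ψ ∈ @spinZSector (TorusSite 2 4) _ _ 1 0) (hnorm : star ψ ⬝ᵥ ψ = 1)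
    (heig : Matrix.mulVec (xxzHamiltonian 1 (torusGraph 2 4) (-1) Δ) ψ =
      ((lowestEnergyInSector 1 (xxzHamiltonian 1 (torusGraph 2 4) (-1) Δ) 0 : ℝ) : ℂ) • ψ)
    (hcorner :
      (4 * (star ψ ⬝ᵥ (onSite ![1, 0] (spinRaise 1) * onSite 0 (spinLower 1)) *ᵥ ψ).re +
          2 * ((star ψ ⬝ᵥ (onSite ![1, 1] (spinRaise 1) * onSite 0 (spinLower 1)) *ᵥ ψ).re +
            (star ψ ⬝ᵥ (onSite ![1, 3] (spinRaise 1) * onSite 0 (spinLower 1)) *ᵥ ψ).re) +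
          4 * (star ψ ⬝ᵥ (onSite ![2, 0] (spinRaise 1) * onSite 0 (spinLower 1)) *ᵥ ψ).re +
          4 * (star ψ ⬝ᵥ (onSite ![2, 1] (spinRaise 1) * onSite 0 (spinLower 1)) *ᵥ ψ).re) ^ 2 ≤
        (4 * (1 / 2) + 8 * (star ψ ⬝ᵥ (onSite ![1, 0] (spinRaise 1) * onSite 0 (spinLower 1)) *ᵥ ψ).re +
          2 * ((star ψ ⬝ᵥ (onSite ![1, 1] (spinRaise 1) * onSite 0 (spinLower 1)) *ᵥ ψ).re +
            (star ψ ⬝ᵥ (onSite ![1, 3] (spinRaise 1) * onSite 0 (spinLower 1)) *ᵥ ψ).re)) *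
        (2 * ((star ψ ⬝ᵥ (onSite ![1, 1] (spinRaise 1) * onSite 0 (spinLower 1)) *ᵥ ψ).re +
            (star ψ ⬝ᵥ (onSite ![1, 3] (spinRaise 1) * onSite 0 (spinLower 1)) *ᵥ ψ).re) +
          8 * (star ψ ⬝ᵥ (onSite ![2, 1] (spinRaise 1) * onSite 0 (spinLower 1)) *ᵥ ψ).re +
          4 * (star ψ ⬝ᵥ (onSite ![2, 2] (spinRaise 1) * onSite 0 (spinLower 1)) *ᵥ ψ).re)) :
    ∀ s : ℝ, 0 < s → s ≤ 1 →
      (Matrix.of fun (x y : TorusSite 2 4) => (∑ x' : TorusSite 2 4, ∑ y' : TorusSite 2 4,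
        if (∀ i : Fin 2, (x' i).val / 2 = (x i).val / 2) ∧ (∀ i : Fin 2, (y' i).val / 2 = (y i).val / 2)
        then (star ψ ⬝ᵥ Matrix.mulVec (onSite x' (spinRaise 1) * onSite y' (spinLower 1)) ψ).re
        else 0) ^ s).PosSemidef := by
  haveI : NeZero (4 / 2) := ⟨by decide⟩
  exact (block2_rpow_posSemidef_iff_levyCoeff_nonneg 4 ⟨2, rfl⟩ le_rfl Δ hΔ ψ hψ hnorm heig).2
    (levyCoeff_four_nonneg_of_corner Δ hΔ ψ hψ hnorm heig hcorner)

/-- **The corner from enclosures (certificate interface).** If the five difference-kernel values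
of a sector ground state of `H_4(Δ)`, `Δ ∈ [-1, 0]`, are enclosed as `u ∈ [u⁻, u⁺]`,
`s = F(1,1) + F(1,3) ∈ [s⁻, s⁺]`, `w ≤ w⁺`, `x ∈ [x⁻, x⁺]`, `y⁻ ≤ y`, with `0 ≤ 2s⁻ + 8x⁻ + 4y⁻` and
the numerical corner `(4u⁺ + 2s⁺ + 4w⁺ + 4x⁺)² ≤ (2 + 8u⁻ + 2s⁻)(2s⁻ + 8x⁻ + 4y⁻)`, then the state's
corner inequality holds (all block coefficients are positive, `B ≥ 0` by Perron–Frobenius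
positivity), hence all Lévy coefficients are nonnegative. [folklore] -/
theorem levyCoeff_four_nonneg_of_bounds (Δ : ℝ) (hΔ : Δ ∈ Set.Icc (-1:ℝ) 0)
    (ψ : TensorIndex (TorusSite 2 4) 2 → ℂ)
    (hψ : ψ ∈ @spinZSector (TorusSite 2 4) _ _ 1 0) (hnorm : star ψ ⬝ᵥ ψ = 1)
    (heig : Matrix.mulVec (xxzHamiltonian 1 (torusGraph 2 4) (-1) Δ) ψ =
      ((lowestEnergyInSector 1 (xxzHamiltonian 1 (torusGraph 2 4) (-1) Δ) 0 : ℝ) : ℂ) • ψ)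
    (ulo uhi slo shi whi xlo xhi ylo : ℝ)
    (hu : ulo ≤ (star ψ ⬝ᵥ (onSite ![1, 0] (spinRaise 1) * onSite 0 (spinLower 1)) *ᵥ ψ).re ∧
      (star ψ ⬝ᵥ (onSite ![1, 0] (spinRaise 1) * onSite 0 (spinLower 1)) *ᵥ ψ).re ≤ uhi)
    (hs : slo ≤ (star ψ ⬝ᵥ (onSite ![1, 1] (spinRaise 1) * onSite 0 (spinLower 1)) *ᵥ ψ).re +
        (star ψ ⬝ᵥ (onSite ![1, 3] (spinRaise 1) * onSite 0 (spinLower 1)) *ᵥ ψ).re ∧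
      (star ψ ⬝ᵥ (onSite ![1, 1] (spinRaise 1) * onSite 0 (spinLower 1)) *ᵥ ψ).re +
        (star ψ ⬝ᵥ (onSite ![1, 3] (spinRaise 1) * onSite 0 (spinLower 1)) *ᵥ ψ).re ≤ shi)
    (hw : (star ψ ⬝ᵥ (onSite ![2, 0] (spinRaise 1) * onSite 0 (spinLower 1)) *ᵥ ψ).re ≤ whi)
    (hx : xlo ≤ (star ψ ⬝ᵥ (onSite ![2, 1] (spinRaise 1) * onSite 0 (spinLower 1)) *ᵥ ψ).re ∧
      (star ψ ⬝ᵥ (onSite ![2, 1] (spinRaise 1) * onSite 0 (spinLower 1)) *ᵥ ψ).re ≤ xhi)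
    (hy : ylo ≤ (star ψ ⬝ᵥ (onSite ![2, 2] (spinRaise 1) * onSite 0 (spinLower 1)) *ᵥ ψ).re)
    (hClo : 0 ≤ 2 * slo + 8 * xlo + 4 * ylo)
    (hcheck : (4 * uhi + 2 * shi + 4 * whi + 4 * xhi) ^ 2 ≤
      (2 + 8 * ulo + 2 * slo) * (2 * slo + 8 * xlo + 4 * ylo)) :
    ∀ q : TorusSite 2 2, q ≠ 0 →
      0 ≤ ∑ X : TorusSite 2 2, Real.log (∑ x' : TorusSite 2 4, ∑ y' : TorusSite 2 4,
            if (∀ i : Fin 2, (x' i).val / 2 = (X i).val) ∧ (∀ i : Fin 2, (y' i).val / 2 = 0) then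
              (star ψ ⬝ᵥ Matrix.mulVec
                (onSite x' (spinRaise 1) * onSite y' (spinLower 1)) ψ).re
            else 0) * (torusChar q X).re := by
  have hEven : Even 4 := ⟨2, rfl⟩
  set F : TorusSite 2 4 → ℝ := fun z =>
    (star ψ ⬝ᵥ (onSite z (spinRaise 1) * onSite 0 (spinLower 1)) *ᵥ ψ).re with hFdef
  have hFpos : ∀ z, 0 < F z := fun z =>
    stub_transverseKernelPos 4 hEven le_rfl Δ hΔ ψ hψ hnorm heig z 0
  refine levyCoeff_four_nonneg_of_corner Δ hΔ ψ hψ hnorm heig ?_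
  change (4 * F ![1, 0] + 2 * (F ![1, 1] + F ![1, 3]) + 4 * F ![2, 0] + 4 * F ![2, 1]) ^ 2 ≤
    (4 * (1 / 2) + 8 * F ![1, 0] + 2 * (F ![1, 1] + F ![1, 3])) *
      (2 * (F ![1, 1] + F ![1, 3]) + 8 * F ![2, 1] + 4 * F ![2, 2])
  change ulo ≤ F ![1, 0] ∧ F ![1, 0] ≤ uhi at hu
  change slo ≤ F ![1, 1] + F ![1, 3] ∧ F ![1, 1] + F ![1, 3] ≤ shi at hs
  change F ![2, 0] ≤ whi at hw
  change xlo ≤ F ![2, 1] ∧ F ![2, 1] ≤ xhi at hx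
  change ylo ≤ F ![2, 2] at hy
  have hB0 : 0 ≤ 4 * F ![1, 0] + 2 * (F ![1, 1] + F ![1, 3]) + 4 * F ![2, 0] + 4 * F ![2, 1] := by
    linarith [hFpos ![1, 0], hFpos ![1, 1], hFpos ![1, 3], hFpos ![2, 0], hFpos ![2, 1]]
  have hBle : 4 * F ![1, 0] + 2 * (F ![1, 1] + F ![1, 3]) + 4 * F ![2, 0] + 4 * F ![2, 1] ≤
      4 * uhi + 2 * shi + 4 * whi + 4 * xhi := by linarith [hu.2, hs.2, hw, hx.2]
  have hAle : 2 + 8 * ulo + 2 * slo ≤ 4 * (1 / 2) + 8 * F ![1, 0] + 2 * (F ![1, 1] + F ![1, 3]) := by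
    linarith [hu.1, hs.1]
  have hCle : 2 * slo + 8 * xlo + 4 * ylo ≤ 2 * (F ![1, 1] + F ![1, 3]) + 8 * F ![2, 1] + 4 * F ![2, 2] := by
    linarith [hs.1, hx.1, hy]
  have hAlo : 0 ≤ 2 + 8 * ulo + 2 * slo := by
    by_contra h
    push Not at h
    have h1 : (2 + 8 * ulo + 2 * slo) * (2 * slo + 8 * xlo + 4 * ylo) ≤ 0 :=
      mul_nonpos_of_nonpos_of_nonneg h.le hClo
    have h2 : (4 * uhi + 2 * shi + 4 * whi + 4 * xhi) ^ 2 ≤ 0 := hcheck.trans h1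
    have h3 : 4 * uhi + 2 * shi + 4 * whi + 4 * xhi = 0 := by nlinarith [sq_nonneg (4 * uhi + 2 * shi + 4 * whi + 4 * xhi)]
    have h4 : 4 * F ![1, 0] + 2 * (F ![1, 1] + F ![1, 3]) + 4 * F ![2, 0] + 4 * F ![2, 1] ≤ 0 := by
      linarith
    linarith [hFpos ![1, 0], hFpos ![1, 1], hFpos ![1, 3], hFpos ![2, 0], hFpos ![2, 1]]
  calc (4 * F ![1, 0] + 2 * (F ![1, 1] + F ![1, 3]) + 4 * F ![2, 0] + 4 * F ![2, 1]) ^ 2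
      ≤ (4 * uhi + 2 * shi + 4 * whi + 4 * xhi) ^ 2 := pow_le_pow_left₀ hB0 hBle 2
    _ ≤ (2 + 8 * ulo + 2 * slo) * (2 * slo + 8 * xlo + 4 * ylo) := hcheck
    _ ≤ (4 * (1 / 2) + 8 * F ![1, 0] + 2 * (F ![1, 1] + F ![1, 3])) *
          (2 * (F ![1, 1] + F ![1, 3]) + 8 * F ![2, 1] + 4 * F ![2, 2]) :=
        mul_le_mul hAle hCle hClo (hAlo.trans hAle)

/-- **The `M = 4` slice of the crux at any `Δ ∈ [-1, 0]` from rational enclosures** (certificate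
interface; `levyCoeff_four_nonneg_of_bounds` + `block2_rpow_posSemidef_iff_levyCoeff_nonneg`):
enclose the five difference-kernel values of the sector ground state of `H_4(Δ)` and check one
inequality on the bounds; then every fractional Hadamard power of the 2×2-block kernel (the crux's
`16 × 16` matrix at `M = 4`, verbatim) is positive semidefinite. [folklore] -/
theorem block2InfDivXXZ_four_of_bounds :
    ∀ (Δ : ℝ), Δ ∈ Set.Icc (-1:ℝ) 0 → ∀ (ψ : TensorIndex (TorusSite 2 4) 2 → ℂ),
      ψ ∈ @spinZSector (TorusSite 2 4) _ _ 1 0 → star ψ ⬝ᵥ ψ = 1 →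
      Matrix.mulVec (xxzHamiltonian 1 (torusGraph 2 4) (-1) Δ) ψ =
        ((lowestEnergyInSector 1 (xxzHamiltonian 1 (torusGraph 2 4) (-1) Δ) 0 : ℝ) : ℂ) • ψ →
      ∀ (ulo uhi slo shi whi xlo xhi ylo : ℝ),
      (ulo ≤ (star ψ ⬝ᵥ (onSite ![1, 0] (spinRaise 1) * onSite 0 (spinLower 1)) *ᵥ ψ).re ∧
        (star ψ ⬝ᵥ (onSite ![1, 0] (spinRaise 1) * onSite 0 (spinLower 1)) *ᵥ ψ).re ≤ uhi) →
      (slo ≤ (star ψ ⬝ᵥ (onSite ![1, 1] (spinRaise 1) * onSite 0 (spinLower 1)) *ᵥ ψ).re +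
          (star ψ ⬝ᵥ (onSite ![1, 3] (spinRaise 1) * onSite 0 (spinLower 1)) *ᵥ ψ).re ∧
        (star ψ ⬝ᵥ (onSite ![1, 1] (spinRaise 1) * onSite 0 (spinLower 1)) *ᵥ ψ).re +
          (star ψ ⬝ᵥ (onSite ![1, 3] (spinRaise 1) * onSite 0 (spinLower 1)) *ᵥ ψ).re ≤ shi) →
      (star ψ ⬝ᵥ (onSite ![2, 0] (spinRaise 1) * onSite 0 (spinLower 1)) *ᵥ ψ).re ≤ whi →
      (xlo ≤ (star ψ ⬝ᵥ (onSite ![2, 1] (spinRaise 1) * onSite 0 (spinLower 1)) *ᵥ ψ).re ∧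
        (star ψ ⬝ᵥ (onSite ![2, 1] (spinRaise 1) * onSite 0 (spinLower 1)) *ᵥ ψ).re ≤ xhi) →
      ylo ≤ (star ψ ⬝ᵥ (onSite ![2, 2] (spinRaise 1) * onSite 0 (spinLower 1)) *ᵥ ψ).re →
      0 ≤ 2 * slo + 8 * xlo + 4 * ylo →
      (4 * uhi + 2 * shi + 4 * whi + 4 * xhi) ^ 2 ≤
        (2 + 8 * ulo + 2 * slo) * (2 * slo + 8 * xlo + 4 * ylo) →
      ∀ s : ℝ, 0 < s → s ≤ 1 →
        (Matrix.of fun (x y : TorusSite 2 4) => (∑ x' : TorusSite 2 4, ∑ y' : TorusSite 2 4,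
          if (∀ i : Fin 2, (x' i).val / 2 = (x i).val / 2) ∧
              (∀ i : Fin 2, (y' i).val / 2 = (y i).val / 2)
          then (star ψ ⬝ᵥ Matrix.mulVec (onSite x' (spinRaise 1) * onSite y' (spinLower 1)) ψ).re
          else 0) ^ s).PosSemidef := by
  intro Δ hΔ ψ hψ hnorm heig ulo uhi slo shi whi xlo xhi ylo hu hs hw hx hy hClo hcheck
  haveI : NeZero (4 / 2) := ⟨by decide⟩
  exact (block2_rpow_posSemidef_iff_levyCoeff_nonneg 4 ⟨2, rfl⟩ le_rfl Δ hΔ ψ hψ hnorm heig).2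
    (levyCoeff_four_nonneg_of_bounds Δ hΔ ψ hψ hnorm heig ulo uhi slo shi whi xlo xhi ylo hu hs hw
      hx hy hClo hcheck)

end FourTorus

end Summit.HubbardSuperconductivity.HubbardSuperconductivity.Theorems.LevyLogBootstrap

end
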